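import Mathlib

/-!
# `T4Continuum.CovariantMeanReweighting` (cell-tree module `Summits/QuantumFields/BalabanUV/T4Continuum/Support/CovariantMeanReweighting.lean`)
# — road P4 of the spine estimate NE1′: the LOGICAL SKELETON of the route «IL-dec at real data by uniform log-concavity» (record
# `t4/b2b-balaban-t4-ne1p-p4/IL-LOC.md` v1.1 §5′) as finite algebra — (i) the REWEIGHTING IDENTITY: changing the far data multiplies
# the (positive) weight by a factor `h`, and `E_{w·h}[F] − E_w[F] = Cov_w(F, h) / E_w[h]`; (ii) the COVARIANCE-DECAY HYPOTHESIS SHAPE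
# `CovDecay w grad K` («|Cov_w(F, G)| ≤ Σ_{x,y} grad F x · K x y · grad G y», the TYPE of the Helffer–Sjöstrand / Brascamp–Lieb
# covariance estimate for uniformly log-concave lattice measures, with `K` the decaying kernel of the inverse Witten Laplacian —
# asserted of nothing); (iii) the CONCLUSION: if `F`'s gradient profile lives on `Y`, `h`'s lives at distance `≥ R` from `Y`, and
# `K x y ≤ c·e^{−κ·dist x y}`, then `|E_{w·h}[F] − E_w[F]| ≤ c·e^{−κR}·(Σ grad F)(Σ grad h) / E_w[h]` — the shape IL-dec-real
# (cell `pub-balaban`, sub-cell `t4`, ROUND-2 prover seat #4 of BINDER-OWNERS row NE1′, unit `b2b-balaban-t4-ne1p-p4`, generation 3;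
# ADDITIVE — imports Mathlib only; nothing modified)

HONEST FRAMING.  Finite four-torus, rung (B)+1 only.  NOT infinite volume, NOT a mass gap, NOT the Clay problem, NOT summit progress.
HONEST DEPENDENCY: continuum YM on T⁴ ⇐ BetaPertH ∧ nine spine estimates (0/9 proved); BetaPertH ⇐ (D1) ∧ (D4) ∧ CAP+tail; G-an2-4
gates asym, D1 and NE2/3/4.  This module is finite algebra over a finite weighted space (a MODEL of a positive Gibbs weight; the road's
real-data fluctuation measure is a continuum Gaussian-type integral — the identity and the bookkeeping are the same, the measure theory is
not done here); `CovDecay` is a hypothesis SHAPE asserted of nothing; every declaration is [folklore] and sorry-free.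

CITATION HEADER (lean-in-tree rule).  No page of any source is quoted or attributed here.  The published theorem whose TYPE `CovDecay`
records (B. Helffer, J. Funct. Anal. 155 (1998) 571–586, Thm 2.1 and §4; B. Helffer, J. Sjöstrand, J. Stat. Phys. 74 (1994) 349–409)
is named in the record `IL-LOC.md` §5′, not cited by any declaration.

REVISION v1.1 (additive; every v1 declaration byte-identical, v1 = p212891): `doubleSum_le_of_profiles`,
`mean_reweight_sub_le_of_profiles` — the PROFILE form ((H5) used twice, as exponential tails of the minimizer map, not supports;
answer Q-p4-ILdec-1 (c), journal l.9011).
-/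

noncomputable section

open Finset

namespace Summit.QuantumFields.BalabanUV.T4Continuum.CovariantMeanReweighting

variable {Ω : Type*} [Fintype Ω]

/-! ## §1 Weighted means, covariance, and the reweighting identity -/

/-- The total weight `Z_w = Σ_ω w ω`. [folklore] -/
def Z (w : Ω → ℝ) : ℝ := ∑ ω, w ω

/-- The weighted mean `E_w[F] = (Σ_ω w ω · F ω) / Z_w`. [folklore] -/
def mean (w : Ω → ℝ) (F : Ω → ℝ) : ℝ := (∑ ω, w ω * F ω) / Z w

/-- The weighted covariance `Cov_w(F, G) = E_w[F·G] − E_w[F]·E_w[G]`. [folklore] -/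
def cov (w : Ω → ℝ) (F G : Ω → ℝ) : ℝ := mean w (fun ω => F ω * G ω) - mean w F * mean w G

/-- Positive weights have positive total weight (for a nonempty space). [folklore] -/
theorem Z_pos [Nonempty Ω] {w : Ω → ℝ} (hw : ∀ ω, 0 < w ω) : 0 < Z w := by
  unfold Z
  exact sum_pos (fun ω _ => hw ω) univ_nonempty

/-- `E_w[1] = 1`. [folklore] -/
theorem mean_one [Nonempty Ω] {w : Ω → ℝ} (hw : ∀ ω, 0 < w ω) : mean w (fun _ => (1 : ℝ)) = 1 := by
  unfold mean
  simp only [mul_one]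
  exact div_self (Z_pos hw).ne'

/-- The mean of a positive function under positive weights is positive. [folklore] -/
theorem mean_pos [Nonempty Ω] {w h : Ω → ℝ} (hw : ∀ ω, 0 < w ω) (hh : ∀ ω, 0 < h ω) : 0 < mean w h := by
  unfold mean
  exact div_pos (sum_pos (fun ω _ => mul_pos (hw ω) (hh ω)) univ_nonempty) (Z_pos hw)

/-- `Z_{w·h} = Z_w · E_w[h]`. [folklore] -/
theorem Z_mul [Nonempty Ω] {w : Ω → ℝ} (hw : ∀ ω, 0 < w ω) (h : Ω → ℝ) :
    Z (fun ω => w ω * h ω) = Z w * mean w h := by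
  have hZ' : (∑ ω, w ω) ≠ 0 := by have := (Z_pos hw).ne'; unfold Z at this; exact this
  simp only [mean, Z]
  field_simp

/-- **THE REWEIGHTING IDENTITY (mean form)**: `E_{w·h}[F] = E_w[F·h] / E_w[h]` for positive `w` (and any `h`, with the
division-by-zero convention when `E_w[h] = 0`). [folklore] -/
theorem mean_reweight [Nonempty Ω] {w : Ω → ℝ} (h : Ω → ℝ) (hw : ∀ ω, 0 < w ω) (F : Ω → ℝ) :
    mean (fun ω => w ω * h ω) F = mean w (fun ω => F ω * h ω) / mean w h := by
  have hZ' : (∑ ω, w ω) ≠ 0 := by have := (Z_pos hw).ne'; unfold Z at this; exact this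
  simp only [mean, Z]
  rw [div_div_div_cancel_right₀ hZ']
  congr 1
  exact sum_congr rfl fun ω _ => by ring

/-- **THE REWEIGHTING IDENTITY (covariance form)**: `E_{w·h}[F] − E_w[F] = Cov_w(F, h) / E_w[h]`. [folklore] -/
theorem mean_reweight_sub [Nonempty Ω] {w h : Ω → ℝ} (hw : ∀ ω, 0 < w ω) (hh : ∀ ω, 0 < h ω) (F : Ω → ℝ) :
    mean (fun ω => w ω * h ω) F - mean w F = cov w F h / mean w h := by
  have hEh : mean w h ≠ 0 := (mean_pos hw hh).ne'
  rw [mean_reweight h hw, cov]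
  field_simp

/-! ## §2 The covariance-decay hypothesis shape and the IL-dec-real conclusion -/

section Decay

variable {ι : Type*} [Fintype ι]

/-- THE COVARIANCE-DECAY HYPOTHESIS SHAPE (the TYPE of the Helffer–Sjöstrand / Brascamp–Lieb estimate for uniformly log-concave
lattice measures): covariances are bounded by the gradient profiles of the two functions against a kernel `K` (the inverse Witten
Laplacian's index kernel).  `grad F x ≥ 0` is an abstract «sup of |∂_x F|» assignment.  Asserted of nothing. [folklore] -/
def CovDecay (w : Ω → ℝ) (grad : (Ω → ℝ) → ι → ℝ) (K : ι → ι → ℝ) : Prop :=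
  ∀ F G : Ω → ℝ, |cov w F G| ≤ ∑ x, ∑ y, grad F x * K x y * grad G y

omit [Fintype Ω] in
/-- BOOKKEEPING: if `F`'s gradient profile vanishes off `Y`, `G`'s vanishes off `W`, profiles are non-negative, and `K x y ≤ k₀`
for `x ∈ Y`, `y ∈ W`, then the double sum is `≤ k₀ · (Σ grad F) · (Σ grad G)`. [folklore] -/
theorem doubleSum_le {grad : (Ω → ℝ) → ι → ℝ} {K : ι → ι → ℝ} {F G : Ω → ℝ} {Y W : Finset ι} {k₀ : ℝ}
    (hF0 : ∀ x, 0 ≤ grad F x) (hG0 : ∀ y, 0 ≤ grad G y)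
    (hFY : ∀ x, x ∉ Y → grad F x = 0) (hGW : ∀ y, y ∉ W → grad G y = 0)
    (hK : ∀ x ∈ Y, ∀ y ∈ W, K x y ≤ k₀) :
    ∑ x, ∑ y, grad F x * K x y * grad G y ≤ k₀ * (∑ x, grad F x) * (∑ y, grad G y) := by
  have hterm : ∀ x y, grad F x * K x y * grad G y ≤ grad F x * k₀ * grad G y := by
    intro x y
    by_cases hx : x ∈ Y
    · by_cases hy : y ∈ W
      · have := hK x hx y hy
        have h1 : grad F x * K x y ≤ grad F x * k₀ := mul_le_mul_of_nonneg_left this (hF0 x)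
        exact mul_le_mul_of_nonneg_right h1 (hG0 y)
      · rw [hGW y hy]; simp
    · rw [hFY x hx]; simp
  calc ∑ x, ∑ y, grad F x * K x y * grad G y ≤ ∑ x, ∑ y, grad F x * k₀ * grad G y :=
        sum_le_sum fun x _ => sum_le_sum fun y _ => hterm x y
    _ = k₀ * (∑ x, grad F x) * (∑ y, grad G y) := by
        have e : ∀ x, ∑ y, grad F x * k₀ * grad G y = grad F x * k₀ * ∑ y, grad G y :=
          fun x => by rw [mul_sum]
        simp_rw [e]
        rw [← sum_mul, ← sum_mul]
        ring

/-- **IL-dec-real, SHAPE LEVEL.**  Positive weight `w` with the covariance-decay shape for a kernel `K ≤ c·e^{−κ·dist}`; an insertion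
`F` whose gradient profile lives on `Y`; a reweighting factor `h > 0` (the change of the FAR data) whose gradient profile lives on a
set `W` at distance `≥ R` from `Y`.  Then `|E_{w·h}[F] − E_w[F]| ≤ c·e^{−κR}·(Σ grad F)(Σ grad h) / E_w[h]`: the real-data expectation
of a local insertion depends on far data exponentially weakly. [folklore] -/
theorem mean_reweight_sub_le [Nonempty Ω] {w h F : Ω → ℝ} (hw : ∀ ω, 0 < w ω) (hh : ∀ ω, 0 < h ω)
    {grad : (Ω → ℝ) → ι → ℝ} {K : ι → ι → ℝ} (hCD : CovDecay w grad K) {dist : ι → ι → ℝ} {c κ R : ℝ}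
    (hc : 0 ≤ c) (hκ : 0 ≤ κ) (hK : ∀ x y, K x y ≤ c * Real.exp (-(κ * dist x y)))
    {Y W : Finset ι} (hF0 : ∀ x, 0 ≤ grad F x) (hh0 : ∀ y, 0 ≤ grad h y)
    (hFY : ∀ x, x ∉ Y → grad F x = 0) (hhW : ∀ y, y ∉ W → grad h y = 0) (hfar : ∀ x ∈ Y, ∀ y ∈ W, R ≤ dist x y) :
    |mean (fun ω => w ω * h ω) F - mean w F| ≤
      c * Real.exp (-(κ * R)) * (∑ x, grad F x) * (∑ y, grad h y) / mean w h := by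
  have hEh : 0 < mean w h := mean_pos hw hh
  rw [mean_reweight_sub hw hh, abs_div, abs_of_pos hEh]
  refine div_le_div_of_nonneg_right ?_ hEh.le
  have hk : ∀ x ∈ Y, ∀ y ∈ W, K x y ≤ c * Real.exp (-(κ * R)) := by
    intro x hx y hy
    refine (hK x y).trans (mul_le_mul_of_nonneg_left ?_ hc)
    exact Real.exp_le_exp.mpr (by nlinarith [hfar x hx y hy])
  exact (hCD F h).trans (doubleSum_le hF0 hh0 hFY hhW hk)

omit [Fintype Ω] in
/-- BOOKKEEPING WITH EXPONENTIAL PROFILES (v1.1): if `grad F x ≤ a_F·e^{−κ·dY x}` (tail away from `Y`), `grad G y ≤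
a_G·e^{−κ·dW y}` (tail away from the far region), `0 ≤ K x y ≤ c·e^{−κ·dist x y}`, and the three distances add up to at least `R`
(`R ≤ dY x + dist x y + dW y`, the triangle inequality between `Y` and the far region), then the double sum is
`≤ |ι|²·c·a_F·a_G·e^{−κR}` — the three exponentials multiply. [folklore] -/
theorem doubleSum_le_of_profiles {grad : (Ω → ℝ) → ι → ℝ} {K : ι → ι → ℝ} {F G : Ω → ℝ}
    {dist : ι → ι → ℝ} {dY dW : ι → ℝ} {c κ R aF aG : ℝ} (hc : 0 ≤ c) (hκ : 0 ≤ κ) (haF : 0 ≤ aF) (haG : 0 ≤ aG)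
    (hG0 : ∀ y, 0 ≤ grad G y) (hK0 : ∀ x y, 0 ≤ K x y)
    (hF : ∀ x, grad F x ≤ aF * Real.exp (-(κ * dY x))) (hG : ∀ y, grad G y ≤ aG * Real.exp (-(κ * dW y)))
    (hK : ∀ x y, K x y ≤ c * Real.exp (-(κ * dist x y))) (htri : ∀ x y, R ≤ dY x + dist x y + dW y) :
    ∑ x, ∑ y, grad F x * K x y * grad G y ≤ (Fintype.card ι : ℝ) ^ 2 * (c * aF * aG * Real.exp (-(κ * R))) := by
  have hterm : ∀ x y, grad F x * K x y * grad G y ≤ c * aF * aG * Real.exp (-(κ * R)) := by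
    intro x y
    have h1 : grad F x * K x y * grad G y ≤
        (aF * Real.exp (-(κ * dY x))) * (c * Real.exp (-(κ * dist x y))) * (aG * Real.exp (-(κ * dW y))) := by
      have e1 := hF x; have e2 := hK x y; have e3 := hG y
      have := mul_le_mul (mul_le_mul e1 e2 (hK0 x y) (by positivity)) e3 (hG0 y) (by positivity)
      exact this
    have h2 : Real.exp (-(κ * dY x)) * Real.exp (-(κ * dist x y)) * Real.exp (-(κ * dW y)) ≤ Real.exp (-(κ * R)) := by
      rw [← Real.exp_add, ← Real.exp_add]
      exact Real.exp_le_exp.mpr (by nlinarith [htri x y])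
    calc grad F x * K x y * grad G y
        ≤ (aF * Real.exp (-(κ * dY x))) * (c * Real.exp (-(κ * dist x y))) * (aG * Real.exp (-(κ * dW y))) := h1
      _ = c * aF * aG * (Real.exp (-(κ * dY x)) * Real.exp (-(κ * dist x y)) * Real.exp (-(κ * dW y))) := by ring
      _ ≤ c * aF * aG * Real.exp (-(κ * R)) := mul_le_mul_of_nonneg_left h2 (by positivity)
  calc ∑ x, ∑ y, grad F x * K x y * grad G y ≤ ∑ _x : ι, ∑ _y : ι, c * aF * aG * Real.exp (-(κ * R)) :=
        sum_le_sum fun x _ => sum_le_sum fun y _ => hterm x y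
    _ = (Fintype.card ι : ℝ) ^ 2 * (c * aF * aG * Real.exp (-(κ * R))) := by
        simp only [sum_const, card_univ]; ring

/-- **IL-dec-real, SHAPE LEVEL, PROFILE FORM (v1.1)** — the form the route actually uses ((H5) twice, as exponential profiles):
positive weight with the covariance-decay shape, insertion `F` with gradient profile `≤ a_F e^{−κ·dY}`, far-data factor `h > 0`
with profile `≤ a_h e^{−κ·dW}`, kernel `≤ c e^{−κ·dist}`, `R ≤ dY + dist + dW`; then
`|E_{w·h}[F] − E_w[F]| ≤ |ι|²·c·a_F·a_h·e^{−κR} / E_w[h]`. [folklore] -/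
theorem mean_reweight_sub_le_of_profiles [Nonempty Ω] {w h F : Ω → ℝ} (hw : ∀ ω, 0 < w ω) (hh : ∀ ω, 0 < h ω)
    {grad : (Ω → ℝ) → ι → ℝ} {K : ι → ι → ℝ} (hCD : CovDecay w grad K) {dist : ι → ι → ℝ} {dY dW : ι → ℝ}
    {c κ R aF ah : ℝ} (hc : 0 ≤ c) (hκ : 0 ≤ κ) (haF : 0 ≤ aF) (hah : 0 ≤ ah)
    (hh0 : ∀ y, 0 ≤ grad h y) (hK0 : ∀ x y, 0 ≤ K x y)
    (hF : ∀ x, grad F x ≤ aF * Real.exp (-(κ * dY x))) (hG : ∀ y, grad h y ≤ ah * Real.exp (-(κ * dW y)))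
    (hK : ∀ x y, K x y ≤ c * Real.exp (-(κ * dist x y))) (htri : ∀ x y, R ≤ dY x + dist x y + dW y) :
    |mean (fun ω => w ω * h ω) F - mean w F| ≤
      (Fintype.card ι : ℝ) ^ 2 * (c * aF * ah * Real.exp (-(κ * R))) / mean w h := by
  have hEh : 0 < mean w h := mean_pos hw hh
  rw [mean_reweight_sub hw hh, abs_div, abs_of_pos hEh]
  refine div_le_div_of_nonneg_right ?_ hEh.le
  exact (hCD F h).trans (doubleSum_le_of_profiles hc hκ haF hah hh0 hK0 hF hG hK htri)

end Decay

end Summit.QuantumFields.BalabanUV.T4Continuum.CovariantMeanReweighting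

end
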